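import Literature.Geometry.Riemannian.PositiveCurvatureOperatorBlocks
import Literature.Geometry.Riemannian.HamiltonNCOClassification
import Literature.Geometry.Riemannian.AlmostNonnegativeCurvatureSmoothing
import HarnessLib

/-!
# Non-negative curvature operator in Hamilton's block form, and its preservation along the Ricci
flow (topic `Geometry/Riemannian`)

A brick of the printed proof of the named fact
`Literature.Geometry.Riemannian.hamilton_nonnegCurvatureOperator_classification_four`
(`HamiltonNCOClassification.lean`; R. S. Hamilton, *Four-manifolds with positive curvature
operator*, J. Differential Geom. 24 (1986), **Thm. 1.3**, p. 154), hence of its simply connected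
consequence `hamilton1986_nonnegCurvatureOperator_four` (`HamiltonNonnegCurvatureOperator.lean`).
The proof of Thm. 1.3 (§§8–9) works with the curvature operator `M = (A B; ᵗB C)` in the block
decomposition `Λ² = Λ²₊ ⊕ Λ²₋` of an orthonormal frame (§6) and opens (**Lemma 8.2**, p. 174,
applied on p. 176 "to the heat equation for the curvature tensor `∂M/∂t = ΔM + M² + M^#`"):

> **8.2. Lemma.** […] Then if `M ≥ 0` at time `t = 0`, it remains so for `t ≥ 0`.

(proof, p. 175: "The convex cone `M ≥ 0` is invariant under parallel translation, and if
`φ(M) ≥ 0` then the ODE `dM/dt = φ(M)` preserves the cone `M ≥ 0`. Hence so does the PDE" — the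
maximum principle for systems of §4, Thm. 4.3). The companion file
`PositiveCurvatureOperatorBlocks.lean` proves the passage from the 2-vector language of the
hypothesis (`Rm(φ, φ)`, `curvatureOperatorForm`) to the block language for POSITIVE curvature
operator; this file records the NON-NEGATIVE case needed by Thm. 1.3:

* `HasNonnegCurvatureOperatorWith.operatorGE_zero_blocks` — **`Rm ≥ 0` (Hamilton's definition,
  p. 153, `HasNonnegCurvatureOperatorWith`) makes `M = (A B; ᵗB C) ≥ 0` (`HamiltonODE.OperatorGE · 0`)
  in every 4-frame** (`quad_blocks_eq_curvatureOperatorForm`: `M(v, v) = Rm(Φ_v, Φ_v)`); the same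
  from the Bamler–Cabezas-Rivas–Wilking phrasing `HasCurvatureOperatorGeWith cov 0` used by
  `hamilton1986_nonnegCurvatureOperator_four` (`HasCurvatureOperatorGeWith.operatorGE_zero_blocks`),
  the two phrasings being the same condition (`hasCurvatureOperatorGeWith_zero_iff_hasNonnegCurvatureOperatorWith`).
* `ricciFlow_operatorGE_zero_of_hasNonnegCurvatureOperatorWith` — **Lemma 8.2, first assertion,
  for the curvature operator of the Ricci flow on a closed 4-manifold: `M ≥ 0` at `t = 0` remains
  so**, in every orthonormal frame at every later time, GIVEN the maximum principle for systems
  (the existing named fact `hamilton_maximumPrinciple_curvatureODE`, Hamilton's Thm. 4.3, taken as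
  a hypothesis exactly as in `ricciFlow_operatorGE_of_hasPositiveCurvatureOperatorWith`) — from
  `ricciFlow_preserves_operatorGE_of_maximumPrinciple` (`HamiltonODEPositiveCone.lean`, the ODE
  invariance of the cone `{M ≥ 0}` being PROVED there, `isInvariantRel_operatorGE`).

Everything is proved; no definition and no named fact is introduced. Not here: the remaining
assertions of Lemma 8.2 (constant rank on `0 < t < δ`, null space parallel and invariant in
time, `null M ⊂ null φ(M)`), which need the strong maximum principle.

## References

* R. S. Hamilton, *Four-manifolds with positive curvature operator*, J. Differential Geom. 24
  (1986) 153–179: §1, p. 153 (definition); §6, p. 165 (`M = (A B; ᵗB C)`); §8, Lemma 8.2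
  (pp. 174–175) and p. 176. [Hamilton1986]
-/

noncomputable section

open Bundle Set Function Matrix Finset
open scoped Manifold ContDiff Topology BigOperators

namespace Literature.Geometry.Riemannian

open Lorentzian Lorentzian.PseudoRiemannianMetric HamiltonODE

/-! ### `Rm ≥ 0` in block form -/

section Pointwise

variable {E : Type*} [NormedAddCommGroup E] [NormedSpace ℝ E] {H : Type*} [TopologicalSpace H]
  {I : ModelWithCorners ℝ E H} {M : Type*} [TopologicalSpace M] [ChartedSpace H M]
  [IsManifold I ∞ M] {n : ℕ∞ω} [FiniteDimensional ℝ E] [CompleteSpace E]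
  {g : PseudoRiemannianMetric I n E (TangentSpace I : M → Type _)}
  {cov : CovariantDerivative I E (TangentSpace I : M → Type _)}

omit [FiniteDimensional ℝ E] [CompleteSpace E] in
/-- Hamilton's `Rm(φ, φ) ≥ 0` (`HasNonnegCurvatureOperatorWith`, `HamiltonNCOClassification.lean`)
and the Bamler–Cabezas-Rivas–Wilking phrasing `Rm ≥ −0` (`HasCurvatureOperatorGeWith cov 0`,
`AlmostNonnegativeCurvatureSmoothing.lean`) are the same condition on the pair `(g, cov)`.
[cite: Hamilton1986, §1, p. 153] -/
theorem _root_.Literature.Geometry.Lorentzian.PseudoRiemannianMetric.hasCurvatureOperatorGeWith_zero_iff_hasNonnegCurvatureOperatorWith :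
    g.HasCurvatureOperatorGeWith cov 0 ↔ g.HasNonnegCurvatureOperatorWith cov := by
  rw [hasCurvatureOperatorGeWith_zero_iff, hasNonnegCurvatureOperatorWith_iff]

/-- **Non-negative curvature operator in block form**: if `(g, cov)` has `Rm(φ, φ) ≥ 0` for every
2-vector (Hamilton 1986, p. 153) and `cov` is a Levi-Civita connection of the `C²` metric `g`,
then in every 4-frame `e` the block quadratic form is non-negative, `M = (A B; ᵗB C) ≥ 0`
(`HamiltonODE.OperatorGE · 0`), since `M(v, v) = Rm(Φ_v, Φ_v)`
(`quad_blocks_eq_curvatureOperatorForm`). The frame need not be orthonormal.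
[cite: Hamilton1986, §1, p. 153; §8, Lemma 8.2 (p. 174)] -/
theorem _root_.Literature.Geometry.Lorentzian.PseudoRiemannianMetric.HasNonnegCurvatureOperatorWith.operatorGE_zero_blocks
    (hR : g.HasNonnegCurvatureOperatorWith cov) (h : g.IsLeviCivita cov) (hn : 2 ≤ n) (x : M)
    (e : Fin 4 → TangentSpace I x) :
    OperatorGE (g.blockA cov x e, g.blockB cov x e, g.blockC cov x e) 0 := by
  intro v
  rw [zero_mul, quad_blocks_eq_curvatureOperatorForm h hn]
  exact hR x _ _ _

/-- The same from the `Rm ≥ −0` phrasing `HasCurvatureOperatorGeWith cov 0`.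
[cite: Hamilton1986, §1, p. 153] -/
theorem _root_.Literature.Geometry.Lorentzian.PseudoRiemannianMetric.HasCurvatureOperatorGeWith.operatorGE_zero_blocks
    (hR : g.HasCurvatureOperatorGeWith cov 0) (h : g.IsLeviCivita cov) (hn : 2 ≤ n) (x : M)
    (e : Fin 4 → TangentSpace I x) :
    OperatorGE (g.blockA cov x e, g.blockB cov x e, g.blockC cov x e) 0 :=
  (hasCurvatureOperatorGeWith_zero_iff_hasNonnegCurvatureOperatorWith.1 hR).operatorGE_zero_blocks
    h hn x e

/-- For the metric-level notion (`HasNonnegCurvatureOperator`: every Levi-Civita connection of `g`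
has `Rm ≥ 0`): `M ≥ 0` in every frame for every Levi-Civita connection.
[cite: Hamilton1986, §1, p. 153] -/
theorem _root_.Literature.Geometry.Lorentzian.PseudoRiemannianMetric.HasNonnegCurvatureOperator.operatorGE_zero_blocks
    (hR : g.HasNonnegCurvatureOperator) (h : g.IsLeviCivita cov) (hn : 2 ≤ n) (x : M)
    (e : Fin 4 → TangentSpace I x) :
    OperatorGE (g.blockA cov x e, g.blockB cov x e, g.blockC cov x e) 0 :=
  (hR cov h).operatorGE_zero_blocks h hn x e

end Pointwise

/-! ### Lemma 8.2, first assertion: `M ≥ 0` is preserved along the Ricci flow -/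

universe u

/-- **Hamilton 1986, Lemma 8.2 (first assertion) for the curvature operator of the Ricci flow on
a closed 4-manifold: "if `M ≥ 0` at time `t = 0`, it remains so for `t ≥ 0`"** — GIVEN the
maximum principle for systems (Thm. 4.3, the named fact `hamilton_maximumPrinciple_curvatureODE`,
hypothesis `hMP`). Along a Ricci flow `(g, cov)` of Riemannian metrics on `[0, T)` on a closed
smooth 4-manifold whose initial pair has `Rm ≥ 0` (`HasNonnegCurvatureOperatorWith`), the blocks
`(A, B, C)` of `(g t, cov t)` satisfy `M ≥ 0` in every `g t`-orthonormal frame for every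
`t ∈ [0, T)`. Proof: `operatorGE_zero_blocks` at `t = 0` and
`ricciFlow_preserves_operatorGE_of_maximumPrinciple` with `m = 0` (the cone `{M ≥ 0}` is forward
invariant under `M' = M² + M^#`, `HamiltonODE.isInvariantRel_operatorGE`; p. 175: "if `φ(M) ≥ 0`
then the ODE `dM/dt = φ(M)` preserves the cone `M ≥ 0`. Hence so does the PDE").
[cite: Hamilton1986, §8, Lemma 8.2 (pp. 174–175); §4, Thm. 4.3 (p. 162)] -/
theorem ricciFlow_operatorGE_zero_of_hasNonnegCurvatureOperatorWith
    (hMP : hamilton_maximumPrinciple_curvatureODE.{u})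
    (M : Type u) [TopologicalSpace M] [T2Space M] [SecondCountableTopology M] [CompactSpace M]
    [ChartedSpace (EuclideanSpace ℝ (Fin 4)) M] [IsManifold (𝓡 4) ∞ M] (T : ℝ)
    (g : ℝ → PseudoRiemannianMetric (𝓡 4) ∞ (EuclideanSpace ℝ (Fin 4))
      (TangentSpace (𝓡 4) : M → Type _))
    (cov : ℝ → CovariantDerivative (𝓡 4) (EuclideanSpace ℝ (Fin 4))
      (TangentSpace (𝓡 4) : M → Type _))
    (hflow : IsRicciFlow g cov (Ico 0 T)) (hRiem : ∀ t ∈ Ico 0 T, (g t).IsRiemannian)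
    (hR : (g 0).HasNonnegCurvatureOperatorWith (cov 0)) :
    ∀ t ∈ Ico 0 T, ∀ (x : M) (e : Fin 4 → TangentSpace (𝓡 4) x),
      (g t).IsOrthonormalFrame x e →
        OperatorGE ((g t).blockA (cov t) x e, (g t).blockB (cov t) x e, (g t).blockC (cov t) x e)
          0 := by
  intro t ht
  have hT : 0 < T := ht.1.trans_lt ht.2
  have hLC : (g 0).IsLeviCivita (cov 0) := hflow.isLeviCivita 0 ⟨le_rfl, hT⟩
  have hn : (2 : ℕ∞ω) ≤ ∞ := WithTop.coe_le_coe.mpr le_top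
  exact ricciFlow_preserves_operatorGE_of_maximumPrinciple hMP M T g cov hflow hRiem le_rfl
    (fun x e _ ↦ hR.operatorGE_zero_blocks hLC hn x e) t ht

/-- The same with the initial condition in the `Rm ≥ −0` phrasing of
`hamilton1986_nonnegCurvatureOperator_four` (`HasCurvatureOperatorGeWith (cov 0) 0`).
[cite: Hamilton1986, §8, Lemma 8.2 (pp. 174–175)] -/
theorem ricciFlow_operatorGE_zero_of_hasCurvatureOperatorGeWith_zero
    (hMP : hamilton_maximumPrinciple_curvatureODE.{u})
    (M : Type u) [TopologicalSpace M] [T2Space M] [SecondCountableTopology M] [CompactSpace M]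
    [ChartedSpace (EuclideanSpace ℝ (Fin 4)) M] [IsManifold (𝓡 4) ∞ M] (T : ℝ)
    (g : ℝ → PseudoRiemannianMetric (𝓡 4) ∞ (EuclideanSpace ℝ (Fin 4))
      (TangentSpace (𝓡 4) : M → Type _))
    (cov : ℝ → CovariantDerivative (𝓡 4) (EuclideanSpace ℝ (Fin 4))
      (TangentSpace (𝓡 4) : M → Type _))
    (hflow : IsRicciFlow g cov (Ico 0 T)) (hRiem : ∀ t ∈ Ico 0 T, (g t).IsRiemannian)
    (hR : (g 0).HasCurvatureOperatorGeWith (cov 0) 0) :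
    ∀ t ∈ Ico 0 T, ∀ (x : M) (e : Fin 4 → TangentSpace (𝓡 4) x),
      (g t).IsOrthonormalFrame x e →
        OperatorGE ((g t).blockA (cov t) x e, (g t).blockB (cov t) x e, (g t).blockC (cov t) x e)
          0 :=
  ricciFlow_operatorGE_zero_of_hasNonnegCurvatureOperatorWith hMP M T g cov hflow hRiem
    (hasCurvatureOperatorGeWith_zero_iff_hasNonnegCurvatureOperatorWith.1 hR)

end Literature.Geometry.Riemannian

end
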